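import Summits.CriticalPhenomena.SAWScalingLimit.Theorems.SAWLeftRightFKGLeftRightFKGDefs
import HarnessLib

/-!
# Stub `stub_endpointMonotone` of line `corner-localisation`, helper file 1: finite sums

Crux `LeftRightFKG` (stmt-CriticalPhenomena-11232), vocabulary module
`Summits.CriticalPhenomena.SAWScalingLimit.Theorems.SAWLeftRightFKGLeftRightFKGDefs`.

The fugacity-blind bookkeeping of the endpoint-monotonicity induction, in abstract form: a
finite set `s` of weighted items (weights `w > 0`), a "row" event `P`, a "column" event `Q` and a
target event `U`. Writing `BI(s; P, U)` for the block inequality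
`w(s ∩ P) · w(s ∩ U) ≤ w(s) · w(s ∩ P ∩ U)` (i.e. `P(U | P) ≥ P(U | s)`):

* `mix`: the real-algebra heart — a two-member increasing mixture is monotone in its weight
  (division-free, with the degenerate blocks handled);
* `bi_step`: `BI(s; P, U)` from `BI` on the two column halves (same kind), `BI` for `Q` on the
  two row halves (other kind), the corner inequality `BI(s; P, Q)` and NON-DIAGONALITY
  (`P ≠ Q` on `s`);
* `bi_of_rel`: the DIAGONAL case — if every item outside `P` is related to every item inside `P`
  by a relation under which `U` is up-closed, `BI(s; P, U)` holds trivially;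
* `μx_bi_iff`: the dictionary between the measure form `μ(A ∩ S) μ(B ∩ S) ≤ μ(S) μ(A ∩ B ∩ S)` of
  the vocabulary (`PAfor`) and the real block form.
-/

noncomputable section

open Finset
open Literature.Probability.LatticeModels Literature.Probability.RandomPlanarGeometry
open scoped Classical ENNReal

namespace Summit.CriticalPhenomena.SAWScalingLimit.Theorems.LeftRightFKG.CornerLoc

namespace EndpointMonotone

/-! ## The real-algebra lemma -/

/-- MONOTONE MIXTURE LEMMA (division-free). Blocks `a, b, c, d ≥ 0` (masses of
`P∩Q, P∩Qᶜ, Pᶜ∩Q, Pᶜ∩Qᶜ`) with sub-masses `α ≤ a, …, δ ≤ d` of `U`; hypotheses: `U` is denser in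
`P∩Q` than in `Pᶜ∩Q` (`h1`), in `P∩Qᶜ` than in `Pᶜ∩Qᶜ` (`h2`), in `P∩Q` than in `P∩Qᶜ` (`h3`),
in `Pᶜ∩Q` than in `Pᶜ∩Qᶜ` (`h4`), `Q` is denser in `P` than in `Pᶜ` (`hC`), and the
configuration is not diagonal (`0 < b + c`). Conclusion: `U` is denser in `P` than in `Pᶜ`.
[cite: EsaryProschanWalkup1967, Theorem 2.1] -/
theorem mix {a b c d α β γ δ : ℝ} (ha : 0 ≤ a) (hb : 0 ≤ b) (hc : 0 ≤ c) (hd : 0 ≤ d)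
    (hβ : 0 ≤ β) (hγ : 0 ≤ γ) (hβb : β ≤ b) (hγc : γ ≤ c) (hδd : δ ≤ d) (hbc : 0 < b + c)
    (h1 : a * γ ≤ c * α) (h2 : b * δ ≤ d * β) (h3 : a * β ≤ b * α) (h4 : c * δ ≤ d * γ)
    (hC : b * c ≤ a * d) :
    (a + b) * (γ + δ) ≤ (c + d) * (α + β) := by
  rcases hb.eq_or_lt with rfl | hb'
  · have hβ0 : β = 0 := le_antisymm hβb hβ
    subst hβ0
    have hc' : 0 < c := by simpa using hbc
    have key : c * (a * δ) ≤ c * (d * α) := by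
      nlinarith [mul_le_mul_of_nonneg_left h4 ha, mul_le_mul_of_nonneg_left h1 hd]
    have := le_of_mul_le_mul_left key hc'
    nlinarith
  rcases hc.eq_or_lt with rfl | hc'
  · have hγ0 : γ = 0 := le_antisymm hγc hγ
    subst hγ0
    have key : b * (a * δ) ≤ b * (d * α) := by
      nlinarith [mul_le_mul_of_nonneg_left h2 ha, mul_le_mul_of_nonneg_left h3 hd]
    have := le_of_mul_le_mul_left key hb'
    nlinarith
  have hd' : 0 < d := by
    rcases hd.eq_or_lt with rfl | h
    · nlinarith [mul_pos hb' hc']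
    · exact h
  have hcd : 0 < c * d := mul_pos hc' hd'
  have key : c * d * ((c + d) * (α + β) - (a + b) * (γ + δ)) =
      (c * d + d ^ 2) * (c * α - a * γ) + (c * d + c ^ 2) * (d * β - b * δ) +
        (d * γ - c * δ) * (a * d - b * c) := by
    ring
  have hnonneg : 0 ≤ c * d * ((c + d) * (α + β) - (a + b) * (γ + δ)) := by
    rw [key]
    have := mul_nonneg (sub_nonneg.2 h4) (sub_nonneg.2 hC)
    have := mul_nonneg (by positivity : 0 ≤ c * d + d ^ 2) (sub_nonneg.2 h1)
    have := mul_nonneg (by positivity : 0 ≤ c * d + c ^ 2) (sub_nonneg.2 h2)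
    linarith
  have : c * d * ((a + b) * (γ + δ)) ≤ c * d * ((c + d) * (α + β)) := by nlinarith [hnonneg]
  exact le_of_mul_le_mul_left this hcd

/-! ## Abstract block inequalities on a weighted finite set -/

section Abstract

variable {ι : Type*}

/-- Re-bracketing of a double filter under a pointwise equivalence on `s`. [folklore] -/
theorem filter₂_congr (s : Finset ι) {p₁ q₁ p₂ q₂ : ι → Prop} [DecidablePred p₁]
    [DecidablePred q₁] [DecidablePred p₂] [DecidablePred q₂]
    (h : ∀ i ∈ s, (p₁ i ∧ q₁ i ↔ p₂ i ∧ q₂ i)) :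
    (s.filter p₁).filter q₁ = (s.filter p₂).filter q₂ := by
  ext i
  simp only [Finset.mem_filter, and_assoc]
  exact ⟨fun hi => ⟨hi.1, (h i hi.1).1 hi.2⟩, fun hi => ⟨hi.1, (h i hi.1).2 hi.2⟩⟩

/-- Re-bracketing of a triple filter under a pointwise equivalence on `s`. [folklore] -/
theorem filter₃_congr (s : Finset ι) {p₁ q₁ r₁ p₂ q₂ r₂ : ι → Prop} [DecidablePred p₁]
    [DecidablePred q₁] [DecidablePred r₁] [DecidablePred p₂] [DecidablePred q₂]
    [DecidablePred r₂] (h : ∀ i ∈ s, (p₁ i ∧ q₁ i ∧ r₁ i ↔ p₂ i ∧ q₂ i ∧ r₂ i)) :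
    ((s.filter p₁).filter q₁).filter r₁ = ((s.filter p₂).filter q₂).filter r₂ := by
  ext i
  simp only [Finset.mem_filter, and_assoc]
  exact ⟨fun hi => ⟨hi.1, (h i hi.1).1 hi.2⟩, fun hi => ⟨hi.1, (h i hi.1).2 hi.2⟩⟩

/-- A sub-filter has smaller mass (nonnegative weights). [folklore] -/
theorem sum_filter_le (s : Finset ι) {w : ι → ℝ} (hw : ∀ i ∈ s, 0 ≤ w i) (p : ι → Prop)
    [DecidablePred p] : ∑ i ∈ s.filter p, w i ≤ ∑ i ∈ s, w i :=
  sum_le_sum_of_subset_of_nonneg (filter_subset _ _) fun i hi _ => hw i hi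

/-- THE INDUCTIVE STEP in abstract form: the block inequality `BI(s; P, U)` from the same
inequality on the two `Q`-halves, the inequality `BI(·; Q, U)` on the two `P`-halves, the corner
inequality `BI(s; P, Q)` and non-diagonality. `P'`, `Q'` are the complements of `P`, `Q` on `s`.
[cite: EsaryProschanWalkup1967, Theorem 2.1] -/
theorem bi_step (s : Finset ι) (w : ι → ℝ) (P P' Q Q' U : Set ι) (hw : ∀ i ∈ s, 0 < w i)
    (hP' : ∀ i ∈ s, (i ∈ P' ↔ i ∉ P)) (hQ' : ∀ i ∈ s, (i ∈ Q' ↔ i ∉ Q))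
    (hnd : ∃ i ∈ s, ¬(i ∈ P ↔ i ∈ Q))
    (hcol : (∑ i ∈ (s.filter (· ∈ Q)).filter (· ∈ P), w i) *
        (∑ i ∈ (s.filter (· ∈ Q)).filter (· ∈ U), w i) ≤
      (∑ i ∈ s.filter (· ∈ Q), w i) *
        ∑ i ∈ ((s.filter (· ∈ Q)).filter (· ∈ P)).filter (· ∈ U), w i)
    (hcol' : (∑ i ∈ (s.filter (· ∈ Q')).filter (· ∈ P), w i) *
        (∑ i ∈ (s.filter (· ∈ Q')).filter (· ∈ U), w i) ≤
      (∑ i ∈ s.filter (· ∈ Q'), w i) *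
        ∑ i ∈ ((s.filter (· ∈ Q')).filter (· ∈ P)).filter (· ∈ U), w i)
    (hrow : (∑ i ∈ (s.filter (· ∈ P)).filter (· ∈ Q), w i) *
        (∑ i ∈ (s.filter (· ∈ P)).filter (· ∈ U), w i) ≤
      (∑ i ∈ s.filter (· ∈ P), w i) *
        ∑ i ∈ ((s.filter (· ∈ P)).filter (· ∈ Q)).filter (· ∈ U), w i)
    (hrow' : (∑ i ∈ (s.filter (· ∈ P')).filter (· ∈ Q), w i) *
        (∑ i ∈ (s.filter (· ∈ P')).filter (· ∈ U), w i) ≤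
      (∑ i ∈ s.filter (· ∈ P'), w i) *
        ∑ i ∈ ((s.filter (· ∈ P')).filter (· ∈ Q)).filter (· ∈ U), w i)
    (hcorner : (∑ i ∈ s.filter (· ∈ P), w i) * (∑ i ∈ s.filter (· ∈ Q), w i) ≤
      (∑ i ∈ s, w i) * ∑ i ∈ (s.filter (· ∈ P)).filter (· ∈ Q), w i) :
    (∑ i ∈ s.filter (· ∈ P), w i) * (∑ i ∈ s.filter (· ∈ U), w i) ≤
      (∑ i ∈ s, w i) * ∑ i ∈ (s.filter (· ∈ P)).filter (· ∈ U), w i := by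
  have hw' : ∀ i ∈ s, 0 ≤ w i := fun i hi => (hw i hi).le
  -- nonnegativity on sub-finsets
  have hwP : ∀ i ∈ s.filter (· ∈ P), 0 ≤ w i := fun i hi => hw' i (filter_subset _ _ hi)
  have hwP' : ∀ i ∈ s.filter (· ∈ P'), 0 ≤ w i := fun i hi => hw' i (filter_subset _ _ hi)
  -- the eight blocks
  set A := (s.filter (· ∈ P)).filter (· ∈ Q) with hA
  set B := (s.filter (· ∈ P)).filter (· ∈ Q') with hB
  set C := (s.filter (· ∈ P')).filter (· ∈ Q) with hC
  set D := (s.filter (· ∈ P')).filter (· ∈ Q') with hD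
  have hwA : ∀ i ∈ A, 0 ≤ w i := fun i hi => hwP i (filter_subset _ _ hi)
  have hwB : ∀ i ∈ B, 0 ≤ w i := fun i hi => hwP i (filter_subset _ _ hi)
  have hwC : ∀ i ∈ C, 0 ≤ w i := fun i hi => hwP' i (filter_subset _ _ hi)
  have hwD : ∀ i ∈ D, 0 ≤ w i := fun i hi => hwP' i (filter_subset _ _ hi)
  -- complements on `s`
  have eB : (s.filter (· ∈ P)).filter (fun i => i ∉ Q) = B :=
    filter₂_congr s fun i hi => by rw [hQ' i hi]
  have eD : (s.filter (· ∈ P')).filter (fun i => i ∉ Q) = D :=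
    filter₂_congr s fun i hi => by rw [hQ' i hi]
  have eP' : s.filter (fun i => i ∉ P) = s.filter (· ∈ P') :=
    filter_congr fun i hi => (hP' i hi).symm
  -- row sums
  have rP : ∑ i ∈ s.filter (· ∈ P), w i = (∑ i ∈ A, w i) + ∑ i ∈ B, w i := by
    rw [← sum_filter_add_sum_filter_not (s.filter (· ∈ P)) (· ∈ Q), eB]
  have rP' : ∑ i ∈ s.filter (· ∈ P'), w i = (∑ i ∈ C, w i) + ∑ i ∈ D, w i := by
    rw [← sum_filter_add_sum_filter_not (s.filter (· ∈ P')) (· ∈ Q), eD]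
  have rs : ∑ i ∈ s, w i = (∑ i ∈ s.filter (· ∈ P), w i) + ∑ i ∈ s.filter (· ∈ P'), w i := by
    rw [← sum_filter_add_sum_filter_not s (· ∈ P), eP']
  -- column sums
  have cQ : ∑ i ∈ s.filter (· ∈ Q), w i = (∑ i ∈ A, w i) + ∑ i ∈ C, w i := by
    rw [← sum_filter_add_sum_filter_not (s.filter (· ∈ Q)) (· ∈ P)]
    congr 1
    · rw [filter₂_congr s (p₂ := (· ∈ P)) (q₂ := (· ∈ Q)) fun i _ => and_comm]
    · rw [filter₂_congr s (p₂ := (· ∈ P')) (q₂ := (· ∈ Q)) fun i hi => by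
        rw [hP' i hi]; exact and_comm]
  have cQ' : ∑ i ∈ s.filter (· ∈ Q'), w i = (∑ i ∈ B, w i) + ∑ i ∈ D, w i := by
    rw [← sum_filter_add_sum_filter_not (s.filter (· ∈ Q')) (· ∈ P)]
    congr 1
    · rw [filter₂_congr s (p₂ := (· ∈ P)) (q₂ := (· ∈ Q')) fun i _ => and_comm]
    · rw [filter₂_congr s (p₂ := (· ∈ P')) (q₂ := (· ∈ Q')) fun i hi => by
        rw [hP' i hi]; exact and_comm]
  -- the `P`-blocks of the columns
  have aQ : (s.filter (· ∈ Q)).filter (· ∈ P) = A := filter₂_congr s fun i _ => and_comm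
  have bQ' : (s.filter (· ∈ Q')).filter (· ∈ P) = B := filter₂_congr s fun i _ => and_comm
  -- `U`-sub-blocks
  have uP : ∑ i ∈ (s.filter (· ∈ P)).filter (· ∈ U), w i =
      (∑ i ∈ A.filter (· ∈ U), w i) + ∑ i ∈ B.filter (· ∈ U), w i := by
    rw [← sum_filter_add_sum_filter_not ((s.filter (· ∈ P)).filter (· ∈ U)) (· ∈ Q)]
    congr 1
    · rw [filter₃_congr s (p₂ := (· ∈ P)) (q₂ := (· ∈ Q)) (r₂ := (· ∈ U)) fun i _ => by tauto]
    · rw [filter₃_congr s (p₂ := (· ∈ P)) (q₂ := (· ∈ Q')) (r₂ := (· ∈ U)) fun i hi => by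
        rw [hQ' i hi]; tauto]
  have uP' : ∑ i ∈ (s.filter (· ∈ P')).filter (· ∈ U), w i =
      (∑ i ∈ C.filter (· ∈ U), w i) + ∑ i ∈ D.filter (· ∈ U), w i := by
    rw [← sum_filter_add_sum_filter_not ((s.filter (· ∈ P')).filter (· ∈ U)) (· ∈ Q)]
    congr 1
    · rw [filter₃_congr s (p₂ := (· ∈ P')) (q₂ := (· ∈ Q)) (r₂ := (· ∈ U)) fun i _ => by
        tauto]
    · rw [filter₃_congr s (p₂ := (· ∈ P')) (q₂ := (· ∈ Q')) (r₂ := (· ∈ U)) fun i hi => by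
        rw [hQ' i hi]; tauto]
  have uQ : ∑ i ∈ (s.filter (· ∈ Q)).filter (· ∈ U), w i =
      (∑ i ∈ A.filter (· ∈ U), w i) + ∑ i ∈ C.filter (· ∈ U), w i := by
    rw [← sum_filter_add_sum_filter_not ((s.filter (· ∈ Q)).filter (· ∈ U)) (· ∈ P)]
    congr 1
    · rw [filter₃_congr s (p₂ := (· ∈ P)) (q₂ := (· ∈ Q)) (r₂ := (· ∈ U)) fun i _ => by tauto]
    · rw [filter₃_congr s (p₂ := (· ∈ P')) (q₂ := (· ∈ Q)) (r₂ := (· ∈ U)) fun i hi => by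
        rw [hP' i hi]; tauto]
  have uQ' : ∑ i ∈ (s.filter (· ∈ Q')).filter (· ∈ U), w i =
      (∑ i ∈ B.filter (· ∈ U), w i) + ∑ i ∈ D.filter (· ∈ U), w i := by
    rw [← sum_filter_add_sum_filter_not ((s.filter (· ∈ Q')).filter (· ∈ U)) (· ∈ P)]
    congr 1
    · rw [filter₃_congr s (p₂ := (· ∈ P)) (q₂ := (· ∈ Q')) (r₂ := (· ∈ U)) fun i _ => by
        tauto]
    · rw [filter₃_congr s (p₂ := (· ∈ P')) (q₂ := (· ∈ Q')) (r₂ := (· ∈ U)) fun i hi => by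
        rw [hP' i hi]; tauto]
  have us : ∑ i ∈ s.filter (· ∈ U), w i =
      (∑ i ∈ (s.filter (· ∈ P)).filter (· ∈ U), w i) +
        ∑ i ∈ (s.filter (· ∈ P')).filter (· ∈ U), w i := by
    rw [← sum_filter_add_sum_filter_not (s.filter (· ∈ U)) (· ∈ P)]
    congr 1
    · rw [filter₂_congr s (p₂ := (· ∈ P)) (q₂ := (· ∈ U)) fun i _ => and_comm]
    · rw [filter₂_congr s (p₂ := (· ∈ P')) (q₂ := (· ∈ U)) fun i hi => by
        rw [hP' i hi]; exact and_comm]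
  -- rewrite everything in block form
  rw [aQ, uQ, cQ] at hcol
  rw [bQ', uQ', cQ'] at hcol'
  rw [uP, rP] at hrow
  rw [uP', rP'] at hrow'
  rw [rs, rP, rP', cQ] at hcorner
  rw [us, uP, uP', rs, rP, rP']
  -- non-diagonality: `0 < b + c`
  have hbc : 0 < (∑ i ∈ B, w i) + ∑ i ∈ C, w i := by
    obtain ⟨i, hi, hiPQ⟩ := hnd
    by_cases hiP : i ∈ P
    · have hiQ : i ∉ Q := fun h => hiPQ ⟨fun _ => h, fun _ => hiP⟩
      have hiB : i ∈ B := by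
        rw [hB, Finset.mem_filter, Finset.mem_filter]
        exact ⟨⟨hi, hiP⟩, (hQ' i hi).2 hiQ⟩
      exact add_pos_of_pos_of_nonneg (lt_of_lt_of_le (hw i hi) (single_le_sum hwB hiB))
        (sum_nonneg hwC)
    · have hiQ : i ∈ Q := by
        by_contra h
        exact hiPQ ⟨fun h' => (hiP h').elim, fun h' => (h h').elim⟩
      have hiC : i ∈ C := by
        rw [hC, Finset.mem_filter, Finset.mem_filter]
        exact ⟨⟨hi, (hP' i hi).2 hiP⟩, hiQ⟩
      exact add_pos_of_nonneg_of_pos (sum_nonneg hwB)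
        (lt_of_lt_of_le (hw i hi) (single_le_sum hwC hiC))
  have key := mix (α := ∑ i ∈ A.filter (· ∈ U), w i) (β := ∑ i ∈ B.filter (· ∈ U), w i)
    (γ := ∑ i ∈ C.filter (· ∈ U), w i) (δ := ∑ i ∈ D.filter (· ∈ U), w i)
    (sum_nonneg hwA) (sum_nonneg hwB) (sum_nonneg hwC) (sum_nonneg hwD)
    (sum_nonneg fun i hi => hwB i (filter_subset _ _ hi))
    (sum_nonneg fun i hi => hwC i (filter_subset _ _ hi))
    (sum_filter_le B hwB (· ∈ U)) (sum_filter_le C hwC (· ∈ U)) (sum_filter_le D hwD (· ∈ U))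
    hbc (by linarith [hcol]) (by linarith [hcol']) (by linarith [hrow]) (by linarith [hrow'])
    (by linarith [hcorner])
  linarith [key]

/-- THE DIAGONAL CASE in abstract form: if every item of `s` outside `P` is `R`-related to every
item of `s` inside `P`, and `U` is `R`-up-closed on `s`, then `BI(s; P, U)`. [folklore] -/
theorem bi_of_rel (s : Finset ι) (w : ι → ℝ) (P U : Set ι) (R : ι → ι → Prop)
    (hw : ∀ i ∈ s, 0 ≤ w i) (hR : ∀ i ∈ s, ∀ j ∈ s, i ∉ P → j ∈ P → R i j)
    (hU : ∀ i ∈ s, ∀ j ∈ s, R i j → i ∈ U → j ∈ U) :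
    (∑ i ∈ s.filter (· ∈ P), w i) * (∑ i ∈ s.filter (· ∈ U), w i) ≤
      (∑ i ∈ s, w i) * ∑ i ∈ (s.filter (· ∈ P)).filter (· ∈ U), w i := by
  by_cases h : ∃ i ∈ s, i ∉ P ∧ i ∈ U
  · obtain ⟨i, hi, hiP, hiU⟩ := h
    have hPU : (s.filter (· ∈ P)).filter (· ∈ U) = s.filter (· ∈ P) := by
      refine filter_true_of_mem fun j hj => ?_
      rw [Finset.mem_filter] at hj
      exact hU i hi j hj.1 (hR i hi j hj.1 hiP hj.2) hiU
    rw [hPU, mul_comm]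
    exact mul_le_mul_of_nonneg_right (sum_filter_le s hw _)
      (sum_nonneg fun j hj => hw j (filter_subset _ _ hj))
  · push Not at h
    have hUP : s.filter (· ∈ U) = (s.filter (· ∈ P)).filter (· ∈ U) := by
      ext j
      simp only [Finset.mem_filter]
      exact ⟨fun hj => ⟨⟨hj.1, by_contra fun hjP => h j hj.1 hjP hj.2⟩, hj.2⟩,
        fun hj => ⟨hj.1.1, hj.2⟩⟩
    rw [hUP]
    exact mul_le_mul_of_nonneg_right (sum_filter_le s hw _)
      (sum_nonneg fun j hj => hw j (filter_subset _ _ (filter_subset _ _ hj)))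

/-- THE TRIVIAL CASE: `P` is constant on `s`. [folklore] -/
theorem bi_of_const (s : Finset ι) (w : ι → ℝ) (P U : Set ι) (hw : ∀ i ∈ s, 0 ≤ w i)
    (h : ∀ i ∈ s, ∀ j ∈ s, (i ∈ P ↔ j ∈ P)) :
    (∑ i ∈ s.filter (· ∈ P), w i) * (∑ i ∈ s.filter (· ∈ U), w i) ≤
      (∑ i ∈ s, w i) * ∑ i ∈ (s.filter (· ∈ P)).filter (· ∈ U), w i :=
  bi_of_rel s w P U (fun _ _ => False) hw (fun i hi j hj hiP hjP => (hiP ((h i hi j hj).2 hjP)))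
    fun _ _ _ _ h _ => h.elim

end Abstract

/-! ## Dictionary with the measure form of the vocabulary -/

section Measure

variable {Ω : Set ℂ} {δ : ℝ} {a b : Site 2}

/-- The measure of `A ∩ S` as a real sum over the `A`-filter of the `S`-finset. [folklore] -/
theorem μx_inter [Fintype (SAW.DomainSAW Ω δ a b)] {x : ℝ} (hx : 0 ≤ x)
    (A S : Set (SAW.DomainSAW Ω δ a b)) :
    μx x Ω δ a b (A ∩ S) =
      ENNReal.ofReal (∑ γ ∈ (univ.filter (· ∈ S)).filter (· ∈ A), x ^ γ.length) := by
  rw [μx_apply_eq_ofReal hx]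
  congr 1
  refine Finset.sum_congr ?_ fun _ _ => rfl
  ext γ
  simp only [Finset.mem_filter, Finset.mem_univ, true_and, Set.mem_inter_iff]
  tauto

/-- The measure of `A ∩ B ∩ S` as a real sum over the `B`-filter of the `A`-filter of the
`S`-finset. [folklore] -/
theorem μx_inter_inter [Fintype (SAW.DomainSAW Ω δ a b)] {x : ℝ} (hx : 0 ≤ x)
    (A B S : Set (SAW.DomainSAW Ω δ a b)) :
    μx x Ω δ a b (A ∩ B ∩ S) = ENNReal.ofReal
      (∑ γ ∈ ((univ.filter (· ∈ S)).filter (· ∈ A)).filter (· ∈ B), x ^ γ.length) := by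
  rw [μx_apply_eq_ofReal hx]
  congr 1
  refine Finset.sum_congr ?_ fun _ _ => rfl
  ext γ
  simp only [Finset.mem_filter, Finset.mem_univ, true_and, Set.mem_inter_iff]
  tauto

/-- DICTIONARY: the `PAfor`-shaped measure inequality for `(A, B)` on `S` is the real block
inequality `BI(S; A, B)` for the weights `x ^ |γ|`, `x ≥ 0`. [folklore] -/
theorem μx_bi_iff [Fintype (SAW.DomainSAW Ω δ a b)] {x : ℝ} (hx : 0 ≤ x)
    (A B S : Set (SAW.DomainSAW Ω δ a b)) :
    μx x Ω δ a b (A ∩ S) * μx x Ω δ a b (B ∩ S) ≤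
        μx x Ω δ a b S * μx x Ω δ a b (A ∩ B ∩ S) ↔
      (∑ γ ∈ (univ.filter (· ∈ S)).filter (· ∈ A), x ^ γ.length) *
          (∑ γ ∈ (univ.filter (· ∈ S)).filter (· ∈ B), x ^ γ.length) ≤
        (∑ γ ∈ univ.filter (· ∈ S), x ^ γ.length) *
          ∑ γ ∈ ((univ.filter (· ∈ S)).filter (· ∈ A)).filter (· ∈ B), x ^ γ.length := by
  rw [μx_inter hx, μx_inter hx, μx_inter_inter hx, μx_apply_eq_ofReal hx S,
    ← ENNReal.ofReal_mul (sum_nonneg fun γ _ => pow_nonneg hx _),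
    ← ENNReal.ofReal_mul (sum_nonneg fun γ _ => pow_nonneg hx _),
    ENNReal.ofReal_le_ofReal_iff (mul_nonneg (sum_nonneg fun γ _ => pow_nonneg hx _)
      (sum_nonneg fun γ _ => pow_nonneg hx _))]

end Measure

end EndpointMonotone

/-- REGISTERED SUB-GOAL `stub_endpointMonotoneAux1` of stub `stub_endpointMonotone` (this helper
file's main lemma, recorded on the crux item so that the file lands as a `--supports` proof): the
MONOTONE MIXTURE LEMMA `EndpointMonotone.mix` — division-free form of "a two-member increasing
mixture is monotone in its weight", degenerate blocks included.
[cite: EsaryProschanWalkup1967, Theorem 2.1] -/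
theorem stub_endpointMonotoneAux1 : ∀ {a b c d α β γ δ : ℝ}, 0 ≤ a → 0 ≤ b → 0 ≤ c → 0 ≤ d →
    0 ≤ β → 0 ≤ γ → β ≤ b → γ ≤ c → δ ≤ d → 0 < b + c → a * γ ≤ c * α → b * δ ≤ d * β →
    a * β ≤ b * α → c * δ ≤ d * γ → b * c ≤ a * d → (a + b) * (γ + δ) ≤ (c + d) * (α + β) :=
  EndpointMonotone.mix

end Summit.CriticalPhenomena.SAWScalingLimit.Theorems.LeftRightFKG.CornerLoc

end
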